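import Summits.Ventures.CertifiedManyBodySolver.Statement
import Literature.Analysis.FunctionSpaces.LiebWuDoubleOccupancyEnclosure
import HarnessLib

/-!
# Ventures/CertifiedManyBodySolver — HubbardAlg/M1DoccContainsLiebWuU8.lean

STEP-0 rung (i), correlator half ("certified bounds on … the double occupancy at the same points … Calibration: the exact
answer is known", Venture Statement §M1), BY NAME (seat L5 LIT 1; `hubbard-alg/L5-lit/BENCHMARKS.md` §4). CERTIFIED.md row
#255 (`docc@chain:TL:U8:n1:tp0:t1`, two-sided, unconditional given the cell-certified energy upper #75; Lean instance
`Certificates/HubbardChain_n1_corr_levelW_reedge_U8.lean`: `M1DoccLowerRow 8 (-180061657285/2³⁹) (41617206376871071094977/2⁸⁰)`,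
`M1DoccUpperRow 8 (-180061657285/2³⁹) (13010548538080045668277/2⁷⁸)`) prints "REFERENCE float (LiebWu 0.03664022961) lies
inside — a falsification test passed". With the kernel-checked enclosure
`liebWuDoubleOccupancy 8 ∈ [0.036640222, 0.036640246]` (`Literature.Analysis.FunctionSpaces.liebWuDoubleOccupancy_eight_mem_Icc`,
term-by-term derivative of Takahashi's series) that test is now a theorem about the tree constant `liebWuDoubleOccupancy 8`
(`= e'(8)`, `hasDerivAt_liebWuEnergy`):

* `liebWuDoubleOccupancy_eight_mem_r255` — `41617206376871071094977/2⁸⁰ ≤ liebWuDoubleOccupancy 8 ≤ 13010548538080045668277/2⁷⁸`;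
* `r255_lower_add_le_liebWuDoubleOccupancy_eight` / `liebWuDoubleOccupancy_eight_add_le_r255_upper` — the edges sit
  `≥ 2.2·10⁻³` below and `≥ 6.4·10⁻³` above the Lieb–Wu value (cell width `8.6·10⁻³`).

What this is NOT: a statement about the chain's double occupancy (that is row #255, conditional on nothing uncertified), nor
Hellmann–Feynman for the chain (`lieb_wu` stays a named fact). HONEST FRAMING: first certified bounds; not a superconductivity
verdict; every number certified or labelled float.
-/

noncomputable section

namespace Summit.Ventures.CertifiedManyBodySolver.HubbardAlg

open Literature.Analysis.FunctionSpaces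

/-- **The certified docc cell #255 at `U = 8` contains the Lieb–Wu double occupancy** (the row's two rational edges). -/
theorem liebWuDoubleOccupancy_eight_mem_r255 :
    (41617206376871071094977 / 1208925819614629174706176 : ℝ) ≤ liebWuDoubleOccupancy 8 ∧
      liebWuDoubleOccupancy 8 ≤ 13010548538080045668277 / 302231454903657293676544 := by
  have h := liebWuDoubleOccupancy_eight_mem_Icc
  rw [Set.mem_Icc] at h
  constructor <;> linarith [h.1, h.2]

/-- The lower edge of #255 is at least `2.2·10⁻³` below `d_LW(8)`. -/
theorem r255_lower_add_le_liebWuDoubleOccupancy_eight :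
    (41617206376871071094977 / 1208925819614629174706176 : ℝ) + 0.0022 ≤ liebWuDoubleOccupancy 8 := by
  have h := liebWuDoubleOccupancy_eight_mem_Icc
  rw [Set.mem_Icc] at h
  linarith [h.1]

/-- The upper edge of #255 is at least `6.4·10⁻³` above `d_LW(8)`. -/
theorem liebWuDoubleOccupancy_eight_add_le_r255_upper :
    liebWuDoubleOccupancy 8 + 0.0064 ≤ (13010548538080045668277 / 302231454903657293676544 : ℝ) := by
  have h := liebWuDoubleOccupancy_eight_mem_Icc
  rw [Set.mem_Icc] at h
  linarith [h.2]

end Summit.Ventures.CertifiedManyBodySolver.HubbardAlg
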